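import Summits.QuantumFields.YangMills.Theorems.UnitScaleTiltProp7SigmaRowsNorm
import Summits.QuantumFields.YangMills.Theorems.UnitScaleTiltProp7SecondOrderDictT3
import HarnessLib

/-!
# Route `UnitScaleTilt`, crux K1 «MinimiserStabilityRegPr» (stmt-QuantumFields-19200), route-R E′ architecture (A′) «HCOW-VIA-Σ», package P-A4 —
# **THE DV-SEAM**: the member's covariant-divergence square `‖D*_{W}X̃‖²` (weighted `L²` letters `DstarL2 ∕ toL2`, spacing `η = L^{−(K−n)}`, weight `c₀`)
# IS `c₀·η⁻²` times the LATTICE divergence square `Σ_x Σ_{jk} |(D¹*_W X)(x)_{jk}|²` written in lit-balaban's `divB ∕ torusT` letters — the currency of the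
# junction door's (DIV-SLICE) cell and of P-A2's level-mass rows; hence the P-A4 member row `‖D*_W X̃‖² ≤ C·‖X̃‖²` reads `DIV(W, X) ≤ 2C·ℓ⁻²·Σ_b‖X b‖²`.

Cell `ym3-torus`, width seat `ym3-torus-px12` (gen 6; explicit-unit helper, `--supports stmt-QuantumFields-19200 --as helper`, count-neutral; NO claim on
crux ∕ stub ∕ registry).  THEOREMS ONLY (0 `def`, 0 `sorry`).  YM₃ on T³ is a ladder rung (R3), not the Clay problem; nothing here claims the (DIV-SLICE) row,
`hcoS`, (A′), E′, a stub, the crux, d = 4 or the mass gap.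

WHY.  The junction door ✓`Prop7HcoSOfSigmaRows.hcoS_of_sigmaRowsS` (p691484) displays the cell (DIV-SLICE) `0 ≤ C₂ ∧ dv ≤ ζ·K + δ₁·((L^{K−n})²)⁻¹·Σ_b‖X b‖²`, where
`dv` is the divergence square entering the JOINT row in P-A2's currency — the letter of ✓`Prop7FibreLevelMassPerLevelT3.sum_normSq_levelRatio_le_LOnly_T3`,
`Σ_x Σ_j Σ_k ‖(divB (torusT (F.P K) 0) (fun κ z ↦ unitsField (toUField W) ⟨z, κ⟩) (fun κ z ↦ Y ⟨z, κ⟩) x) j k‖²` (unit lattice, Frobenius; E2E spec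
`E2E-SIGMA-SPEC-p1g17` row DIV-SLICE: «`dv := Σ_x‖(D*_W X)(x)‖²`»).  The P-A4 pen's member reading ✓`Prop7DivSqOfCombBernsteinRow.div_sq_le_of_competitorRow`
(p692842) and its knit `…DivSqCurvedOfRegPr` (px19 g5) conclude in the MEMBER's letters, `‖DstarL2 F n K c₀ W (toL2 F K c₀ X)‖² ≤ C·‖toL2 F K c₀ X‖²`.  This file
is the dictionary between the two (no file of the tree contained both `DstarL2` and `divB` before it), composed BY NAME from ✓`Prop7LandauDict.DstarL2_toL2_eq_covDivFormT`
((3.8) at the member = the route's `covDivFormT η`), ✓`Prop7SecondOrderDict.covDerivT_eq_smul_covDstar` (`D^{η*}_μ = η⁻¹·D^{1*}_μ`, route letters = lit-balaban's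
on `torusT`), ✓`Prop7LaplaceAFlatLetters.norm_sq_toL2S` (`‖·‖² = c₀·Σ Frobenius²`) and ★p1's ✓`Prop7SigmaRowsNorm.norm_sq_toL2_le_two_mul` (p689273, the (NORM)
row's companion `‖toL2 X‖² ≤ 2c₀·Σ_b‖X b‖²`).

WHAT IS PROVED (ns `…Theorems.Prop7DivSliceOfMemberDivSq`; member `F`, heights `n K`, weight `c₀ > 0`, any background `W`, any one-form `X`).
* §1 `covDivFormT_eta_eq_smul_divB` (the route's `D^{η*}_W X` = `η⁻¹ •` lit-balaban's `divB`), ★ `toL2S_symm_DstarL2_toL2_eq` (the member's `D*_W X̃` read back on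
  the sites = `η⁻¹ • divB`).
* §2 ★★ `norm_sq_DstarL2_toL2_eq` — `‖DstarL2 W (toL2 X)‖² = c₀·((L^{K−n})²)·DIV(W, X)`; ★★ `sum_normSq_divB_eq` — `DIV(W, X) = c₀⁻¹·((L^{K−n})²)⁻¹·‖DstarL2 W (toL2 X)‖²`.
* §3 ★★★ `sum_normSq_divB_le_of_memberDivSq` — `‖DstarL2 W (toL2 X)‖² ≤ C·‖toL2 X‖²` ⟹ `DIV(W, X) ≤ 2·C·((L^{K−n})²)⁻¹·Σ_b‖X b‖²` (the (DIV-SLICE) shape with `ζ = 0`,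
  `δ₁ = 2C`); `…_doorShape` adds the vacuous `0·K` slot.
* §4 `divB_smul_I`, `sum_normSq_divB_smul_I` (`DIV(W, I•X) = DIV(W, X)`), ★★★ `sum_normSq_divB_smul_I_le_of_memberDivSq` — the same at the JOINT row's LINEAR field
  `fun κ z ↦ Complex.I • X ⟨z, κ⟩` (the letter of routeR-w4 g15's `Prop7PertVarCurrencyExchange.divHS_pertVar_le` right side, token for token).
HONEST SCOPE.  Letter bookkeeping (re-indexing, one real scalar `η`, Frobenius vs operator norm); no estimate of Bałaban's is asserted; the member row is a
displayed HYPOTHESIS `hmem` (its inhabitant at `RegPr` backgrounds is the P-A4 knit, px19 g5).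

References: T. Bałaban, CMP **99** (1985) 389–434 [Balaban1985BackgroundPropagators] ((3.8) p.392, (3.11) p.392); CMP **99** (1985) 75–102 [Balaban1985RegularSpaces]
((1.1)–(1.2) p.76, (1.38) p.82); CMP **102** (1985) 277–309 [Balaban1985Variational] ((21) p.281, Prop. 7 p.299); CMP **98** (1985) 17–51 [Balaban1985Averaging] ((20) p.21).
-/

set_option autoImplicit false

noncomputable section

open scoped Matrix.Norms.L2Operator BigOperators

namespace Summit.QuantumFields.YangMills.Theorems.Prop7DivSliceOfMemberDivSq

open Literature.MathematicalPhysics.QuantumFieldTheory.Balaban1983to89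
open Literature.MathematicalPhysics.QuantumFieldTheory.Balaban1983to89.T3ContinuumYM3Torus
open T3SectALandauChart (formComp covDivFormT bgUnits eta eta_pos)
open B10Eq68TorusRegularity (covDerivT)
open B10Eq27TorusAxialLog (unitsField toUField)
open B9Eq39Adjoint (covDstar divB covDstar_smul)
open B9TorusCalculus (torusT)
open Summit.QuantumFields.YangMills.Theorems.Prop7SectET3HilbertLetters (W₂ toL2 toL2S DstarL2)
open Summit.QuantumFields.YangMills.Theorems.Prop7SecondOrderDict (covDerivT_eq_smul_covDstar)
open Summit.QuantumFields.YangMills.Theorems.Prop7LandauDict (DstarL2_toL2_eq_covDivFormT)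
open Summit.QuantumFields.YangMills.Theorems.Prop7LaplaceAFlatLetters (norm_sq_toL2S)
open Summit.QuantumFields.YangMills.Theorems.Prop7SigmaRowsNorm (norm_sq_toL2_le_two_mul)

variable (F : T3Family) (n K : ℕ) (c₀ : ℝ)

/-! ## §1 The route's `D^{η*}_W` is `η⁻¹ •` lit-balaban's `divB` on `torusT`; the member's `D*_W X̃` read back on the sites -/

/-- **(1.2) = η⁻¹·(3.8)**: the route's covariant divergence of a one-form at spacing `η`, background `bgUnits F K W = unitsField (toUField W)`, is `η⁻¹` times
lit-balaban's unit-lattice `divB` on the torus of record. [cite: Balaban1985RegularSpaces, (1.1)–(1.2) p.76; Balaban1985BackgroundPropagators, (3.8) p.392] -/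
theorem covDivFormT_eta_eq_smul_divB (η : ℝ) (W : GaugeField (F.P K) 0 (Matrix.specialUnitaryGroup (Fin 2) ℂ)) (X : PBond (F.P K) 0 → Matrix (Fin 2) (Fin 2) ℂ)
    (x : Site (F.P K) 0) :
    covDivFormT η (bgUnits F K W) X x
      = η⁻¹ • divB (torusT (F.P K) 0) (fun κ z => unitsField (toUField W) ⟨z, κ⟩) (fun κ z => X ⟨z, κ⟩) x := by
  simp only [covDivFormT, divB, covDerivT_eq_smul_covDstar, Finset.smul_sum]
  rfl

variable [Fact (0 < c₀)]

/-- ★ **THE MEMBER's `D*_W X̃` ON THE SITES**: `(toL2S)⁻¹(DstarL2 W (toL2 X)) = η⁻¹ • divB_W X` (`η = eta F n K`). [cite: Balaban1985BackgroundPropagators, (3.8) p.392] -/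
theorem toL2S_symm_DstarL2_toL2_eq (W : GaugeField (F.P K) 0 (Matrix.specialUnitaryGroup (Fin 2) ℂ)) (X : PBond (F.P K) 0 → Matrix (Fin 2) (Fin 2) ℂ) :
    (toL2S F K c₀).symm (DstarL2 F n K c₀ W (toL2 F K c₀ X))
      = fun x => (eta F n K)⁻¹ • divB (torusT (F.P K) 0) (fun κ z => unitsField (toUField W) ⟨z, κ⟩) (fun κ z => X ⟨z, κ⟩) x := by
  funext x
  rw [DstarL2_toL2_eq_covDivFormT F n K c₀ W X x, covDivFormT_eta_eq_smul_divB F K (eta F n K) W X x]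

/-- … equivalently `DstarL2 W (toL2 X) = toL2S (η⁻¹ • divB_W X)`. [cite: Balaban1985BackgroundPropagators, (3.8) p.392] -/
theorem DstarL2_toL2_eq_toL2S (W : GaugeField (F.P K) 0 (Matrix.specialUnitaryGroup (Fin 2) ℂ)) (X : PBond (F.P K) 0 → Matrix (Fin 2) (Fin 2) ℂ) :
    DstarL2 F n K c₀ W (toL2 F K c₀ X)
      = toL2S F K c₀ (fun x => (eta F n K)⁻¹ • divB (torusT (F.P K) 0) (fun κ z => unitsField (toUField W) ⟨z, κ⟩) (fun κ z => X ⟨z, κ⟩) x) := by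
  rw [← toL2S_symm_DstarL2_toL2_eq F n K c₀ W X, LinearEquiv.apply_symm_apply]

/-! ## §2 ★★ The identity `‖D*_W X̃‖² = c₀·(L^{K−n})²·DIV(W, X)` -/

/-- `η⁻² = (L^{K−n})²` (`η = (L⁻¹)^{K−n}`). [cite: Balaban1985Variational, (2) p.278] -/
theorem inv_eta_sq_eq : ((eta F n K)⁻¹) ^ 2 = ((F.L : ℝ) ^ (K - n)) ^ 2 := by
  rw [T3SectALandauChart.eta, ← inv_pow, inv_inv]

/-- `η² = ((L^{K−n})²)⁻¹`. [cite: Balaban1985Variational, (2) p.278] -/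
theorem eta_sq_eq : (eta F n K) ^ 2 = (((F.L : ℝ) ^ (K - n)) ^ 2)⁻¹ := by
  rw [← inv_eta_sq_eq, inv_pow, inv_inv]

/-- ★★ **THE DV-SEAM, MEMBER → LATTICE**: `‖DstarL2 W (toL2 X)‖² = c₀·(L^{K−n})²·Σ_x Σ_j Σ_k |(divB_W X)(x)_{jk}|²` — print's (3.11) weight `c₀`, the spacing factor
`η⁻¹` of (3.8) squared, Frobenius entries. [cite: Balaban1985BackgroundPropagators, (3.8) p.392, (3.11) p.392; Balaban1985RegularSpaces, (1.2) p.76] -/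
theorem norm_sq_DstarL2_toL2_eq (W : GaugeField (F.P K) 0 (Matrix.specialUnitaryGroup (Fin 2) ℂ)) (X : PBond (F.P K) 0 → Matrix (Fin 2) (Fin 2) ℂ) :
    ‖DstarL2 F n K c₀ W (toL2 F K c₀ X)‖ ^ 2
      = c₀ * ((F.L : ℝ) ^ (K - n)) ^ 2 *
          ∑ x : Site (F.P K) 0, ∑ j : Fin 2, ∑ k : Fin 2,
            ‖(divB (torusT (F.P K) 0) (fun κ z => unitsField (toUField W) ⟨z, κ⟩) (fun κ z => X ⟨z, κ⟩) x) j k‖ ^ 2 := by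
  rw [DstarL2_toL2_eq_toL2S F n K c₀ W X, norm_sq_toL2S, ← inv_eta_sq_eq F n K, mul_assoc]
  congr 1
  rw [Finset.mul_sum]
  refine Finset.sum_congr rfl fun x _ => ?_
  rw [Finset.mul_sum]
  refine Finset.sum_congr rfl fun j _ => ?_
  rw [Finset.mul_sum]
  refine Finset.sum_congr rfl fun k _ => ?_
  rw [Matrix.smul_apply, norm_smul, mul_pow, Real.norm_eq_abs, sq_abs]

/-- ★★ **THE DV-SEAM, LATTICE → MEMBER**: `Σ_x Σ_j Σ_k |(divB_W X)(x)_{jk}|² = c₀⁻¹·((L^{K−n})²)⁻¹·‖DstarL2 W (toL2 X)‖²`.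
[cite: Balaban1985BackgroundPropagators, (3.8) p.392, (3.11) p.392; Balaban1985RegularSpaces, (1.2) p.76] -/
theorem sum_normSq_divB_eq (W : GaugeField (F.P K) 0 (Matrix.specialUnitaryGroup (Fin 2) ℂ)) (X : PBond (F.P K) 0 → Matrix (Fin 2) (Fin 2) ℂ) :
    ∑ x : Site (F.P K) 0, ∑ j : Fin 2, ∑ k : Fin 2,
        ‖(divB (torusT (F.P K) 0) (fun κ z => unitsField (toUField W) ⟨z, κ⟩) (fun κ z => X ⟨z, κ⟩) x) j k‖ ^ 2
      = c₀⁻¹ * (((F.L : ℝ) ^ (K - n)) ^ 2)⁻¹ * ‖DstarL2 F n K c₀ W (toL2 F K c₀ X)‖ ^ 2 := by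
  have hc : (0 : ℝ) < c₀ := Fact.out
  have hℓ : (0 : ℝ) < ((F.L : ℝ) ^ (K - n)) ^ 2 := by
    rw [← inv_eta_sq_eq]; exact pow_pos (inv_pos.mpr (eta_pos F n K)) 2
  rw [norm_sq_DstarL2_toL2_eq F n K c₀ W X]
  set S := ∑ x : Site (F.P K) 0, ∑ j : Fin 2, ∑ k : Fin 2,
        ‖(divB (torusT (F.P K) 0) (fun κ z => unitsField (toUField W) ⟨z, κ⟩) (fun κ z => X ⟨z, κ⟩) x) j k‖ ^ 2
  rw [show c₀⁻¹ * (((F.L : ℝ) ^ (K - n)) ^ 2)⁻¹ * (c₀ * ((F.L : ℝ) ^ (K - n)) ^ 2 * S)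
      = (c₀⁻¹ * c₀) * ((((F.L : ℝ) ^ (K - n)) ^ 2)⁻¹ * ((F.L : ℝ) ^ (K - n)) ^ 2) * S by ring,
    inv_mul_cancel₀ hc.ne', inv_mul_cancel₀ hℓ.ne', one_mul, one_mul]

/-! ## §3 ★★★ The (DIV-SLICE) shape from the member row -/

/-- ★★★ **(DIV-SLICE) FROM THE P-A4 MEMBER ROW**: if `‖DstarL2 W (toL2 X)‖² ≤ C·‖toL2 X‖²` (the P-A4 knit's conclusion at `W`, displayed), then
`Σ_x Σ_j Σ_k |(divB_W X)(x)_{jk}|² ≤ 2·C·((L^{K−n})²)⁻¹·Σ_b‖X b‖²` — the junction door's `dv ≤ ζ·K + δ₁·ℓ⁻²·M` with `ζ = 0`, `δ₁ = 2C`.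
[cite: Balaban1985RegularSpaces, (1.38) p.82; Balaban1985Variational, (21) p.281, Prop. 7 p.299; Balaban1985BackgroundPropagators, (3.8), (3.11) p.392] -/
theorem sum_normSq_divB_le_of_memberDivSq (W : GaugeField (F.P K) 0 (Matrix.specialUnitaryGroup (Fin 2) ℂ)) (X : PBond (F.P K) 0 → Matrix (Fin 2) (Fin 2) ℂ)
    {C : ℝ} (hC : 0 ≤ C) (hmem : ‖DstarL2 F n K c₀ W (toL2 F K c₀ X)‖ ^ 2 ≤ C * ‖toL2 F K c₀ X‖ ^ 2) :
    ∑ x : Site (F.P K) 0, ∑ j : Fin 2, ∑ k : Fin 2,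
        ‖(divB (torusT (F.P K) 0) (fun κ z => unitsField (toUField W) ⟨z, κ⟩) (fun κ z => X ⟨z, κ⟩) x) j k‖ ^ 2
      ≤ 2 * C * (((F.L : ℝ) ^ (K - n)) ^ 2)⁻¹ * ∑ b : PBond (F.P K) 0, ‖X b‖ ^ 2 := by
  have hc : (0 : ℝ) < c₀ := Fact.out
  have hℓ : (0 : ℝ) < ((F.L : ℝ) ^ (K - n)) ^ 2 := by
    rw [← inv_eta_sq_eq]; exact pow_pos (inv_pos.mpr (eta_pos F n K)) 2
  have h1 : ‖DstarL2 F n K c₀ W (toL2 F K c₀ X)‖ ^ 2 ≤ C * (2 * c₀ * ∑ b : PBond (F.P K) 0, ‖X b‖ ^ 2) :=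
    hmem.trans (mul_le_mul_of_nonneg_left (norm_sq_toL2_le_two_mul F K c₀ X) hC)
  rw [sum_normSq_divB_eq F n K c₀ W X]
  calc c₀⁻¹ * (((F.L : ℝ) ^ (K - n)) ^ 2)⁻¹ * ‖DstarL2 F n K c₀ W (toL2 F K c₀ X)‖ ^ 2
      ≤ c₀⁻¹ * (((F.L : ℝ) ^ (K - n)) ^ 2)⁻¹ * (C * (2 * c₀ * ∑ b : PBond (F.P K) 0, ‖X b‖ ^ 2)) :=
        mul_le_mul_of_nonneg_left h1 (by positivity)
    _ = 2 * C * (((F.L : ℝ) ^ (K - n)) ^ 2)⁻¹ * ∑ b : PBond (F.P K) 0, ‖X b‖ ^ 2 := by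
        field_simp

/-- The same in the door's literal three-slot shape `dv ≤ ζ·K + δ₁·ℓ⁻²·M` with `ζ = 0` (any plaquette quantity `Kq`). [cite: Balaban1985Variational, Prop. 7 p.299] -/
theorem sum_normSq_divB_le_of_memberDivSq_doorShape (W : GaugeField (F.P K) 0 (Matrix.specialUnitaryGroup (Fin 2) ℂ))
    (X : PBond (F.P K) 0 → Matrix (Fin 2) (Fin 2) ℂ) {C : ℝ} (hC : 0 ≤ C)
    (hmem : ‖DstarL2 F n K c₀ W (toL2 F K c₀ X)‖ ^ 2 ≤ C * ‖toL2 F K c₀ X‖ ^ 2) (Kq : ℝ) :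
    ∑ x : Site (F.P K) 0, ∑ j : Fin 2, ∑ k : Fin 2,
        ‖(divB (torusT (F.P K) 0) (fun κ z => unitsField (toUField W) ⟨z, κ⟩) (fun κ z => X ⟨z, κ⟩) x) j k‖ ^ 2
      ≤ 0 * Kq + (2 * C) * (((F.L : ℝ) ^ (K - n)) ^ 2)⁻¹ * ∑ b : PBond (F.P K) 0, ‖X b‖ ^ 2 := by
  rw [zero_mul, zero_add]
  exact sum_normSq_divB_le_of_memberDivSq F n K c₀ W X hC hmem

/-! ## §4 The JOINT row's field `I • X` has the same divergence square -/

omit [Fact (0 < c₀)] in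
/-- `divB_W (I•X) = I • divB_W X` (`R(U)` is `ℂ`-linear, lit ✓`covDstar_smul`). [cite: Balaban1985BackgroundPropagators, (3.8) p.392] -/
theorem divB_smul_I (W : GaugeField (F.P K) 0 (Matrix.specialUnitaryGroup (Fin 2) ℂ)) (X : PBond (F.P K) 0 → Matrix (Fin 2) (Fin 2) ℂ) (x : Site (F.P K) 0) :
    divB (torusT (F.P K) 0) (fun κ z => unitsField (toUField W) ⟨z, κ⟩) (fun κ z => Complex.I • X ⟨z, κ⟩) x
      = Complex.I • divB (torusT (F.P K) 0) (fun κ z => unitsField (toUField W) ⟨z, κ⟩) (fun κ z => X ⟨z, κ⟩) x := by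
  simp only [divB, Finset.smul_sum]
  refine Finset.sum_congr rfl fun μ _ => ?_
  exact covDstar_smul (torusT (F.P K) 0) (fun κ z => unitsField (toUField W) ⟨z, κ⟩) Complex.I μ (fun z => X ⟨z, μ⟩) x

omit [Fact (0 < c₀)] in
/-- `DIV(W, I•X) = DIV(W, X)` (`|I·z| = |z|` entrywise). [cite: Balaban1985BackgroundPropagators, (3.8) p.392] -/
theorem sum_normSq_divB_smul_I (W : GaugeField (F.P K) 0 (Matrix.specialUnitaryGroup (Fin 2) ℂ)) (X : PBond (F.P K) 0 → Matrix (Fin 2) (Fin 2) ℂ) :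
    ∑ x : Site (F.P K) 0, ∑ j : Fin 2, ∑ k : Fin 2,
        ‖(divB (torusT (F.P K) 0) (fun κ z => unitsField (toUField W) ⟨z, κ⟩) (fun κ z => Complex.I • X ⟨z, κ⟩) x) j k‖ ^ 2
      = ∑ x : Site (F.P K) 0, ∑ j : Fin 2, ∑ k : Fin 2,
        ‖(divB (torusT (F.P K) 0) (fun κ z => unitsField (toUField W) ⟨z, κ⟩) (fun κ z => X ⟨z, κ⟩) x) j k‖ ^ 2 := by
  refine Finset.sum_congr rfl fun x _ => Finset.sum_congr rfl fun j _ => Finset.sum_congr rfl fun k _ => ?_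
  rw [divB_smul_I F K W X x, Matrix.smul_apply, smul_eq_mul, norm_mul, Complex.norm_I, one_mul]

/-- ★★★ **(DIV-SLICE) AT THE JOINT ROW's FIELD `I • X`** from the member row at `X`: `DIV(W, I•X) ≤ 2·C·((L^{K−n})²)⁻¹·Σ_b‖X b‖²`.
[cite: Balaban1985RegularSpaces, (1.38) p.82; Balaban1985Variational, (21) p.281, Prop. 7 p.299] -/
theorem sum_normSq_divB_smul_I_le_of_memberDivSq (W : GaugeField (F.P K) 0 (Matrix.specialUnitaryGroup (Fin 2) ℂ))
    (X : PBond (F.P K) 0 → Matrix (Fin 2) (Fin 2) ℂ) {C : ℝ} (hC : 0 ≤ C)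
    (hmem : ‖DstarL2 F n K c₀ W (toL2 F K c₀ X)‖ ^ 2 ≤ C * ‖toL2 F K c₀ X‖ ^ 2) :
    ∑ x : Site (F.P K) 0, ∑ j : Fin 2, ∑ k : Fin 2,
        ‖(divB (torusT (F.P K) 0) (fun κ z => unitsField (toUField W) ⟨z, κ⟩) (fun κ z => Complex.I • X ⟨z, κ⟩) x) j k‖ ^ 2
      ≤ 2 * C * (((F.L : ℝ) ^ (K - n)) ^ 2)⁻¹ * ∑ b : PBond (F.P K) 0, ‖X b‖ ^ 2 := by
  rw [sum_normSq_divB_smul_I F K W X]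
  exact sum_normSq_divB_le_of_memberDivSq F n K c₀ W X hC hmem

end Summit.QuantumFields.YangMills.Theorems.Prop7DivSliceOfMemberDivSq

end
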